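import Literature.MathematicalPhysics.QuantumLattice.ShastryPairingInequalities
import Literature.MathematicalPhysics.QuantumLattice.FinDimSpectrumProofs
import HarnessLib

/-!
# Discharge of the Sawada–Warke inequality (`ShastryPairingInequalities`)

Sibling proof file of `Literature/MathematicalPhysics/QuantumLattice/ShastryPairingInequalities.lean`:
it discharges the named fact (`def X : Prop`, D-0014)
`Literature.MathematicalPhysics.QuantumLattice.sawadaWarke_inequality` of that file as
`theorem sawadaWarke_inequality_holds : sawadaWarke_inequality`. No statement is introduced or
changed here.

The fact (B. S. Shastry, J. Phys. A 30 (1997) L635, arXiv:cond-mat/9612098, Ineq. (2) of the text,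
`ineq1` of the arXiv source, attributed to K. Sawada, C. S. Warke, Phys. Rev. 133 (1964) A1252,
ref. [sw]): for a ground state `ψ₀` of a Hermitian `H̃` and an ARBITRARY operator `M`,
`⟨ψ₀| M† [H̃, M] |ψ₀⟩ ≥ 0`; Shastry's footnote [sw]: "The inequality is readily proved by inserting a
complete set of energy eigenfunctions."

## Proof

The operator form of the footnote's argument. Put `φ := M ψ₀` and `E₀ := H.minEnergyOn ⊤`, so that
`H ψ₀ = E₀ ψ₀` by hypothesis. Then
`⟨ψ₀, Mᴴ (H M - M H) ψ₀⟩ = ⟨M ψ₀, H M ψ₀ - M H ψ₀⟩ = ⟨φ, H φ⟩ - E₀ ⟨φ, φ⟩ = ⟨φ, (H - E₀) φ⟩ ≥ 0`,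
because on a nonempty index type `E₀ = H.minEnergyOn ⊤ = H.groundEnergy`
(`Matrix.minEnergyOn_top_holds`) and `H - E₀ • 1` is positive semidefinite
(`Matrix.posSemidef_sub_groundEnergy`, the variational principle; both in `FinDimSpectrumProofs`).
Inserting the eigenbasis of `H` into `⟨φ, (H - E₀) φ⟩ = Σₙ (Eₙ - E₀) |⟨n, φ⟩|² ≥ 0` is exactly
Shastry's "complete set of energy eigenfunctions". On an empty index type both sides vanish.

## Sources

B. S. Shastry, *Uncertainty principle enhanced pairing correlations in projected Fermi systems near
half filling*, J. Phys. A 30 (1997) L635–L641, arXiv:cond-mat/9612098 [Shastry1997], Ineq. (2) and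
ref. [sw]; K. Sawada, C. S. Warke, Phys. Rev. 133 (1964) A1252.
-/

noncomputable section

namespace Literature.MathematicalPhysics.QuantumLattice

open Matrix
open scoped ComplexOrder

/-- **Sawada–Warke inequality, discharged** (`sawadaWarke_inequality_holds : sawadaWarke_inequality`):
for a Hermitian matrix `H`, a vector `ψ₀` with `H ψ₀ = E₀ ψ₀`, `E₀ = H.minEnergyOn ⊤` (a ground state,
or `ψ₀ = 0`), and an arbitrary matrix `M`, `0 ≤ re ⟨ψ₀, Mᴴ (H M - M H) ψ₀⟩`. Proof: with `φ := M ψ₀`,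
`⟨ψ₀, Mᴴ (H M - M H) ψ₀⟩ = ⟨φ, (H - E₀) φ⟩ ≥ 0` by the variational principle
(`Matrix.minEnergyOn_top_holds`, `Matrix.posSemidef_sub_groundEnergy`); Shastry: "readily proved by
inserting a complete set of energy eigenfunctions".
[cite: Shastry1997, Ineq. (2) and ref. [sw] (Sawada–Warke, Phys. Rev. 133 (1964) A1252)] -/
theorem sawadaWarke_inequality_holds : sawadaWarke_inequality := by
  intro n _ _ H M ψ₀ hH hψ₀
  rcases isEmpty_or_nonempty n with hn | hn
  · simp [dotProduct]
  -- the variational principle: `H - E₀ ≥ 0` with `E₀ = minEnergyOn H ⊤ = groundEnergy H`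
  have hPSD : (H - algebraMap ℝ (Matrix n n ℂ) (H.minEnergyOn ⊤)).PosSemidef := by
    rw [Matrix.minEnergyOn_top_holds hH]
    exact Matrix.posSemidef_sub_groundEnergy hH
  -- `0 ≤ ⟨M ψ₀, (H - E₀) M ψ₀⟩ = ⟨M ψ₀, H M ψ₀⟩ - E₀ ⟨M ψ₀, M ψ₀⟩`
  have h := hPSD.dotProduct_mulVec_nonneg (M *ᵥ ψ₀)
  rw [sub_mulVec, dotProduct_sub, Algebra.algebraMap_eq_smul_one, smul_mulVec, one_mulVec,
    dotProduct_smul, Complex.real_smul] at h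
  -- `⟨ψ₀, Mᴴ (H M - M H) ψ₀⟩ = ⟨M ψ₀, H M ψ₀⟩ - E₀ ⟨M ψ₀, M ψ₀⟩` using `H ψ₀ = E₀ ψ₀`
  rw [← mulVec_mulVec, sub_mulVec, ← mulVec_mulVec, ← mulVec_mulVec, hψ₀, mulVec_smul,
    dotProduct_mulVec, ← star_mulVec, dotProduct_sub, dotProduct_smul, smul_eq_mul]
  exact (Complex.nonneg_iff.mp h).1

end Literature.MathematicalPhysics.QuantumLattice
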